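import Literature.Probability.LatticeModels.SixVertexGFFProofs

/-!
# Six-vertex model: the planar slope-zero measure is supported on ice configurations and is
# invariant under lattice translations (DKLM 2026, Def. 2.1, Thm. 2.2)

H. Duminil-Copin, K. K. Kozlowski, P. Lammers, I. Manolescu, *Gaussian free field convergence of
the six-vertex model with `-1 ≤ Δ ≤ -1/2`*, arXiv:2603.06268 (2026) [DKLM2026SixVertexGFF], §2.1,
read in the held source (`paper:arxiv-2603.06268`):

> **Definition 2.1.** `W(ω) = 𝟙{ω satisfies the ice rule} · a₁^{n₁} ⋯ c₂^{n₆}` […]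
> **Theorem 2.2.** […] We denote it `ℙ_{ℤ²}` and call it the six-vertex measure in the plane with
> slope zero. It is invariant under the automorphism group of `ℤ²`.

For the objects of `Literature/Probability/LatticeModels/SixVertexGFF.lean` (where Theorem 2.2 is
turned into the predicate `IsPlanarSixVertexMeasure a b c P`) this file proves:

* `IsPlanarSixVertexMeasure.measure_not_iceRuleAt`, `IsPlanarSixVertexMeasure.ae_iceRuleAt` —
  **`P`-almost every configuration satisfies the ice rule at every vertex** (the torus weight
  vanishes off ice configurations, so every torus conditional probability of "ice fails at `v`" is
  `0`, and this window event has `P`-mass `lim lim 0 = 0`);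
* `IsPlanarSixVertexMeasure.map_shift`, `IsPlanarSixVertexMeasure.map_shift_eq`,
  `IsPlanarSixVertexMeasure.integral_shift_eq` — **`P` is invariant under every lattice
  translation** `ω ↦ (w ↦ ω (w + v))`, `v ∈ ℤ²` (the torus measures are translation invariant and
  a translated window event is a larger window event), the translation part of "invariant under
  the automorphism group of `ℤ²`" in Theorem 2.2. Rotations are NOT treated (they exchange the two
  limits `M → ∞`, `L → ∞` of the predicate).

Everything is proved for general symmetric weights `a, b, c` and every `P` satisfying the
predicate; no new definition is introduced (translations are written inline).

## References

* H. Duminil-Copin, K. K. Kozlowski, P. Lammers, I. Manolescu, arXiv:2603.06268 (2026), Def. 2.1,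
  Thm. 2.2. [DKLM2026SixVertexGFF]
-/

noncomputable section

open MeasureTheory Filter Topology ProbabilityTheory
open scoped NNReal BoundedContinuousFunction

namespace Literature.Probability.LatticeModels.SixVertex

/-! ### Congruence lemmas: the local quantities only read three coordinates -/

section Congr

variable {G₁ G₂ : Type*} [AddGroup G₁] [AddGroup G₂] [One G₁] [One G₂]

/-- `inDegree ω v` only depends on `ω v`, `ω (v₁ - 1, v₂)` and `ω (v₁, v₂ - 1)`. [folklore] -/
theorem inDegree_congr {ω ω' : Config (G₁ × G₂)} {v v' : G₁ × G₂} (h0 : ω' v' = ω v)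
    (h1 : ω' (v'.1 - 1, v'.2) = ω (v.1 - 1, v.2)) (h2 : ω' (v'.1, v'.2 - 1) = ω (v.1, v.2 - 1)) :
    inDegree ω' v' = inDegree ω v := by
  unfold inDegree
  rw [h0, h1, h2]

/-- `vertexWeight a b c ω v` only depends on `ω v`, `ω (v₁ - 1, v₂)` and `ω (v₁, v₂ - 1)`. [folklore] -/
theorem vertexWeight_congr (a b c : ℝ) {ω ω' : Config (G₁ × G₂)} {v v' : G₁ × G₂}
    (h0 : ω' v' = ω v) (h1 : ω' (v'.1 - 1, v'.2) = ω (v.1 - 1, v.2))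
    (h2 : ω' (v'.1, v'.2 - 1) = ω (v.1, v.2 - 1)) :
    vertexWeight a b c ω' v' = vertexWeight a b c ω v := by
  unfold vertexWeight
  rw [inDegree_congr h0 h1 h2, h0, h1]

/-- Off the ice rule at `v` the local weight at `v` vanishes (Def. 2.1: `W = 𝟙{ice rule} ⋯`).
[cite: DKLM2026SixVertexGFF, Def. 2.1] -/
theorem vertexWeight_eq_zero_of_ne (a b c : ℝ) {ω : Config (G₁ × G₂)} {v : G₁ × G₂}
    (h : inDegree ω v ≠ 2) : vertexWeight a b c ω v = 0 := by
  unfold vertexWeight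
  rw [if_neg h]

end Congr

/-! ### The torus measures do not charge non-ice configurations -/

section Torus

variable {G₁ G₂ : Type*} [AddGroup G₁] [AddGroup G₂] [One G₁] [One G₂] [Fintype G₁] [Fintype G₂]

/-- Off the ice rule at some vertex the torus weight vanishes. [cite: DKLM2026SixVertexGFF, Def. 2.1] -/
theorem torusWeight_eq_zero_of_ne (a b c : ℝ) {ω : Config (G₁ × G₂)} {v : G₁ × G₂}
    (h : inDegree ω v ≠ 2) : torusWeight a b c ω = 0 := by
  unfold torusWeight
  exact Finset.prod_eq_zero (Finset.mem_univ v) (vertexWeight_eq_zero_of_ne a b c h)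

variable [DecidableEq G₁] [DecidableEq G₂]

/-- `ℙ_{𝕋}[ice rule fails at v | balanced] = 0`. [cite: DKLM2026SixVertexGFF, Def. 2.1] -/
theorem torusCondProb_setOf_inDegree_ne (a b c : ℝ) (v : G₁ × G₂) :
    torusCondProb a b c {ω : Config (G₁ × G₂) | inDegree ω v ≠ 2} = 0 := by
  classical
  unfold torusCondProb
  rw [Finset.sum_eq_zero, zero_div]
  intro ω hω
  simp only [Finset.mem_filter, Finset.mem_univ, true_and, Set.mem_setOf_eq] at hω
  exact torusWeight_eq_zero_of_ne a b c hω.2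

end Torus

/-! ### `P`-almost every configuration is an ice configuration -/

/-- The event "the ice rule fails at `v`" as a window event, together with its torus reading.
[folklore] -/
theorem setOf_not_iceRuleAt_eq_window (v : ℤ × ℤ) :
    ∃ (n : ℕ) (S : Set (Config (Fin (2 * n + 1) × Fin (2 * n + 1)))),
      {ω : Config (ℤ × ℤ) | ¬IceRuleAt ω v} = {ω | planeWindow n ω ∈ S} ∧
        ∀ M L : ℕ, {ω : Config (ZMod M × ZMod L) | torusWindow n ω ∈ S} =
          {ω | inDegree ω ((v.1 : ZMod M), (v.2 : ZMod L)) ≠ 2} := by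
  set n : ℕ := v.1.natAbs + v.2.natAbs + 1 with hn
  have h0 : (v.1 + n).toNat < 2 * n + 1 := by omega
  have h0' : (v.2 + n).toNat < 2 * n + 1 := by omega
  have h1 : (v.1 - 1 + n).toNat < 2 * n + 1 := by omega
  have h2 : (v.2 - 1 + n).toNat < 2 * n + 1 := by omega
  have e0 : (((v.1 + n).toNat : ℕ) : ℤ) - n = v.1 := by omega
  have e0' : (((v.2 + n).toNat : ℕ) : ℤ) - n = v.2 := by omega
  have e1 : (((v.1 - 1 + n).toNat : ℕ) : ℤ) - n = v.1 - 1 := by omega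
  have e2 : (((v.2 - 1 + n).toNat : ℕ) : ℤ) - n = v.2 - 1 := by omega
  refine ⟨n, {w | (if (w (⟨(v.1 + n).toNat, h0⟩, ⟨(v.2 + n).toNat, h0'⟩)).1 = true then 0 else 1) +
      (if (w (⟨(v.1 - 1 + n).toNat, h1⟩, ⟨(v.2 + n).toNat, h0'⟩)).1 = true then 1 else 0) +
      (if (w (⟨(v.1 + n).toNat, h0⟩, ⟨(v.2 + n).toNat, h0'⟩)).2 = true then 0 else 1) +
      (if (w (⟨(v.1 + n).toNat, h0⟩, ⟨(v.2 - 1 + n).toNat, h2⟩)).2 = true then 1 else 0) ≠ 2},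
    ?_, fun M L => ?_⟩
  · ext ω
    simp only [Set.mem_setOf_eq, planeWindow, IceRuleAt, inDegree, e0, e0', e1, e2, Prod.mk.eta]
  · ext ω
    simp only [Set.mem_setOf_eq, torusWindow, inDegree, e0, e0', e1, e2, Int.cast_sub,
      Int.cast_one]

/-- **The planar slope-zero measure does not charge "the ice rule fails at `v`"**: the torus
weight vanishes off ice configurations (Def. 2.1), so each `ℙ_{𝕋_{M,L}}[· | balanced]`-probability
of this window event is `0`, and so is its iterated limit. [cite: DKLM2026SixVertexGFF, Def. 2.1 and Thm. 2.2] -/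
theorem IsPlanarSixVertexMeasure.measure_not_iceRuleAt {a b c : ℝ} {P : Measure (Config (ℤ × ℤ))}
    (hP : IsPlanarSixVertexMeasure a b c P) (v : ℤ × ℤ) :
    P {ω | ¬IceRuleAt ω v} = 0 := by
  haveI := hP.1
  obtain ⟨n, S, hplane, htorus⟩ := setOf_not_iceRuleAt_eq_window v
  obtain ⟨q, hq, hqP⟩ := hP.2 n S
  have hzero : ∀ M L : ℕ, torusCondProbNat a b c M L n S = 0 := by
    intro M L
    unfold torusCondProbNat
    split_ifs with hM hL
    · rfl
    · rfl
    · haveI : NeZero M := ⟨hM⟩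
      haveI : NeZero L := ⟨hL⟩
      rw [htorus M L]
      exact torusCondProb_setOf_inDegree_ne a b c _
  have hq0 : ∀ ℓ, q ℓ = 0 := fun ℓ =>
    tendsto_nhds_unique (hq ℓ) (by simp only [hzero]; exact tendsto_const_nhds)
  have hqfun : q = fun _ => 0 := funext hq0
  have hlim : (P {ω | planeWindow n ω ∈ S}).toReal = 0 :=
    tendsto_nhds_unique hqP (by rw [hqfun]; exact tendsto_const_nhds)
  rw [hplane]
  exact (ENNReal.toReal_eq_zero_iff _).mp hlim |>.resolve_right (measure_ne_top _ _)

/-- **`P`-almost every configuration satisfies the ice rule at every vertex.**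
[cite: DKLM2026SixVertexGFF, Def. 2.1 and Thm. 2.2] -/
theorem IsPlanarSixVertexMeasure.ae_iceRuleAt {a b c : ℝ} {P : Measure (Config (ℤ × ℤ))}
    (hP : IsPlanarSixVertexMeasure a b c P) : ∀ᵐ ω ∂P, ∀ v, IceRuleAt ω v := by
  rw [ae_all_iff]
  intro v
  rw [ae_iff]
  exact hP.measure_not_iceRuleAt v

/-! ### Lattice translations on the torus -/

section Shift

variable {G₁ G₂ : Type*} [AddCommGroup G₁] [AddCommGroup G₂] [One G₁] [One G₂]

/-- Local weights of a translated configuration are the translated local weights. [folklore] -/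
theorem vertexWeight_shift (a b c : ℝ) (ω : Config (G₁ × G₂)) (t w : G₁ × G₂) :
    vertexWeight a b c (fun w' => ω (w' + t)) w = vertexWeight a b c ω (w + t) := by
  refine vertexWeight_congr a b c rfl ?_ ?_
  · show ω ((w.1 - 1, w.2) + t) = ω ((w + t).1 - 1, (w + t).2)
    congr 1
    ext
    · simp only [Prod.fst_add]
      abel
    · simp only [Prod.snd_add]
  · show ω ((w.1, w.2 - 1) + t) = ω ((w + t).1, (w + t).2 - 1)
    congr 1
    ext
    · simp only [Prod.fst_add]
    · simp only [Prod.snd_add]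
      abel

variable [Fintype G₁] [Fintype G₂]

/-- The torus weight is invariant under translations of the torus. [cite: DKLM2026SixVertexGFF, Def. 2.1] -/
theorem torusWeight_shift (a b c : ℝ) (ω : Config (G₁ × G₂)) (t : G₁ × G₂) :
    torusWeight a b c (fun w' => ω (w' + t)) = torusWeight a b c ω := by
  unfold torusWeight
  rw [Finset.prod_congr rfl fun w _ => vertexWeight_shift a b c ω t w]
  exact Fintype.prod_equiv (Equiv.addRight t) _ _ fun w => rfl

omit [One G₁] [One G₂] [Fintype G₁] in
/-- Balancedness is invariant under translations of the torus. [cite: DKLM2026SixVertexGFF, §2.1] -/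
theorem isBalanced_shift_iff (ω : Config (G₁ × G₂)) (t : G₁ × G₂) :
    IsBalanced (fun w' => ω (w' + t)) ↔ IsBalanced ω := by
  simp only [IsBalanced, Finset.card_filter]
  have hsum : ∀ x : G₁, ∑ y : G₂, (if (ω ((x, y) + t)).1 = true then 1 else 0) =
      ∑ y : G₂, (if (ω (x + t.1, y)).1 = true then 1 else 0) := fun x =>
    Fintype.sum_equiv (Equiv.addRight t.2) _ _ fun y => rfl
  constructor
  · intro h x
    have hx := h (x - t.1)
    rw [hsum, sub_add_cancel] at hx
    exact hx
  · intro h x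
    rw [hsum]
    exact h (x + t.1)

variable [DecidableEq G₁] [DecidableEq G₂]

/-- `ℙ_{𝕋}[τ⁻¹ A | balanced] = ℙ_{𝕋}[A | balanced]` for every translation `τ` of the torus: the
conditioned torus measure is translation invariant. [cite: DKLM2026SixVertexGFF, Def. 2.1 and Thm. 2.2] -/
theorem torusCondProb_shift_preimage (a b c : ℝ) (t : G₁ × G₂) (A : Set (Config (G₁ × G₂))) :
    torusCondProb a b c {ω | (fun w' => ω (w' + t)) ∈ A} = torusCondProb a b c A := by
  classical
  let Φ : Config (G₁ × G₂) ≃ Config (G₁ × G₂) :=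
    ⟨fun ω w' => ω (w' + t), fun ω w' => ω (w' - t),
      fun ω => funext fun w' => by simp, fun ω => funext fun w' => by simp⟩
  unfold torusCondProb
  simp only [Finset.sum_filter]
  congr 1
  rw [← Equiv.sum_comp Φ (fun ω => if IsBalanced ω ∧ ω ∈ A then torusWeight a b c ω else 0)]
  refine Finset.sum_congr rfl fun ω _ => ?_
  have hΦω : (Φ ω : Config (G₁ × G₂)) = fun w' => ω (w' + t) := rfl
  have hiff : (IsBalanced ω ∧ ω ∈ {ω : Config (G₁ × G₂) | (fun w' => ω (w' + t)) ∈ A}) ↔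
      (IsBalanced (Φ ω) ∧ (Φ ω) ∈ A) := by
    rw [hΦω, isBalanced_shift_iff]
    rfl
  by_cases h : IsBalanced ω ∧ ω ∈ {ω : Config (G₁ × G₂) | (fun w' => ω (w' + t)) ∈ A}
  · rw [if_pos h, if_pos (hiff.mp h), hΦω, torusWeight_shift]
  · rw [if_neg h, if_neg (fun h' => h (hiff.mpr h'))]

end Shift

/-! ### Lattice translations in the plane and window events -/

/-- Lattice translations of planar configurations are measurable. [folklore] -/
theorem measurable_shift (v : ℤ × ℤ) :
    Measurable (fun (ω : Config (ℤ × ℤ)) (w : ℤ × ℤ) => ω (w + v)) :=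
  measurable_pi_lambda _ fun w => measurable_pi_apply (w + v)

/-- A translated window event is a (larger) window event, and the corresponding torus window
events are translates of each other, for every torus size. [folklore] -/
theorem window_shift (n : ℕ) (v : ℤ × ℤ) (S : Set (Config (Fin (2 * n + 1) × Fin (2 * n + 1)))) :
    ∃ (n' : ℕ) (S' : Set (Config (Fin (2 * n' + 1) × Fin (2 * n' + 1)))),
      {ω : Config (ℤ × ℤ) | planeWindow n (fun w => ω (w + v)) ∈ S} =
          {ω | planeWindow n' ω ∈ S'} ∧
        ∀ M L : ℕ, {ω : Config (ZMod M × ZMod L) | torusWindow n' ω ∈ S'} =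
          {ω | torusWindow n (fun w => ω (w + ((v.1 : ZMod M), (v.2 : ZMod L)))) ∈ S} := by
  set d : ℕ := v.1.natAbs + v.2.natAbs with hd
  have hb1 : ∀ p : Fin (2 * n + 1), ((p : ℤ) + d + v.1).toNat < 2 * (n + d) + 1 := by
    intro p; have := p.2; omega
  have hb2 : ∀ p : Fin (2 * n + 1), ((p : ℤ) + d + v.2).toNat < 2 * (n + d) + 1 := by
    intro p; have := p.2; omega
  have he1 : ∀ p : Fin (2 * n + 1),
      ((((p : ℤ) + d + v.1).toNat : ℕ) : ℤ) - ((n + d : ℕ) : ℤ) = (p : ℤ) - n + v.1 := by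
    intro p; have := p.2; omega
  have he2 : ∀ p : Fin (2 * n + 1),
      ((((p : ℤ) + d + v.2).toNat : ℕ) : ℤ) - ((n + d : ℕ) : ℤ) = (p : ℤ) - n + v.2 := by
    intro p; have := p.2; omega
  refine ⟨n + d, {w' | (fun p : Fin (2 * n + 1) × Fin (2 * n + 1) =>
      w' (⟨((p.1 : ℤ) + d + v.1).toNat, hb1 p.1⟩, ⟨((p.2 : ℤ) + d + v.2).toNat, hb2 p.2⟩)) ∈ S},
    ?_, fun M L => ?_⟩
  · ext ω
    simp only [Set.mem_setOf_eq]
    suffices h : (fun p : Fin (2 * n + 1) × Fin (2 * n + 1) =>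
        planeWindow (n + d) ω
          (⟨((p.1 : ℤ) + d + v.1).toNat, hb1 p.1⟩, ⟨((p.2 : ℤ) + d + v.2).toNat, hb2 p.2⟩)) =
        planeWindow n (fun w => ω (w + v)) by
      rw [h]
    funext p
    simp only [planeWindow]
    rw [he1, he2]
    rfl
  · ext ω
    simp only [Set.mem_setOf_eq]
    suffices h : (fun p : Fin (2 * n + 1) × Fin (2 * n + 1) =>
        torusWindow (n + d) ω
          (⟨((p.1 : ℤ) + d + v.1).toNat, hb1 p.1⟩, ⟨((p.2 : ℤ) + d + v.2).toNat, hb2 p.2⟩)) =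
        torusWindow n (fun w => ω (w + ((v.1 : ZMod M), (v.2 : ZMod L)))) by
      rw [h]
    funext p
    simp only [torusWindow]
    rw [he1, he2]
    simp only [Int.cast_add]
    rfl

/-! ### Translation invariance of the planar slope-zero measure -/

/-- The image of a planar slope-zero measure under a lattice translation is again a planar
slope-zero measure for the same weights. [cite: DKLM2026SixVertexGFF, Thm. 2.2] -/
theorem IsPlanarSixVertexMeasure.map_shift {a b c : ℝ} {P : Measure (Config (ℤ × ℤ))}
    (hP : IsPlanarSixVertexMeasure a b c P) (v : ℤ × ℤ) :
    IsPlanarSixVertexMeasure a b c (P.map fun (ω : Config (ℤ × ℤ)) (w : ℤ × ℤ) => ω (w + v)) := by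
  haveI := hP.1
  refine ⟨Measure.isProbabilityMeasure_map (measurable_shift v).aemeasurable, fun n S => ?_⟩
  obtain ⟨n', S', hplane, htorus⟩ := window_shift n v S
  obtain ⟨q, hq, hqP⟩ := hP.2 n' S'
  have heq : ∀ M L : ℕ, torusCondProbNat a b c M L n S = torusCondProbNat a b c M L n' S' := by
    intro M L
    unfold torusCondProbNat
    split_ifs with hM hL
    · rfl
    · rfl
    · haveI : NeZero M := ⟨hM⟩
      haveI : NeZero L := ⟨hL⟩
      rw [htorus M L]
      exact (torusCondProb_shift_preimage (G₁ := ZMod M) (G₂ := ZMod L) a b c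
        ((v.1 : ZMod M), (v.2 : ZMod L)) {ω : Config (ZMod M × ZMod L) | torusWindow n ω ∈ S}).symm
  refine ⟨q, fun ℓ => ?_, ?_⟩
  · simp only [heq]
    exact hq ℓ
  · rw [Measure.map_apply (measurable_shift v) (measurableSet_window n S)]
    show Tendsto q atTop (𝓝 (P {ω | planeWindow n (fun w => ω (w + v)) ∈ S}).toReal)
    rw [hplane]
    exact hqP

/-- **`ℙ_{ℤ²}` is invariant under lattice translations** (the translation part of "invariant
under the automorphism group of `ℤ²`", Theorem 2.2). [cite: DKLM2026SixVertexGFF, Thm. 2.2] -/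
theorem IsPlanarSixVertexMeasure.map_shift_eq {a b c : ℝ} {P : Measure (Config (ℤ × ℤ))}
    (hP : IsPlanarSixVertexMeasure a b c P) (v : ℤ × ℤ) :
    P.map (fun (ω : Config (ℤ × ℤ)) (w : ℤ × ℤ) => ω (w + v)) = P :=
  (hP.map_shift v).unique hP

/-- Change of variables under a lattice translation: `𝔼_{ℤ²}[F(ω(· + v))] = 𝔼_{ℤ²}[F(ω)]` for
every `F`. [cite: DKLM2026SixVertexGFF, Thm. 2.2] -/
theorem IsPlanarSixVertexMeasure.integral_shift_eq {a b c : ℝ} {P : Measure (Config (ℤ × ℤ))}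
    (hP : IsPlanarSixVertexMeasure a b c P) (v : ℤ × ℤ) (F : Config (ℤ × ℤ) → ℝ) :
    ∫ ω, F (fun w => ω (w + v)) ∂P = ∫ ω, F ω ∂P := by
  let e : Config (ℤ × ℤ) ≃ᵐ Config (ℤ × ℤ) :=
    { toFun := fun ω w => ω (w + v)
      invFun := fun ω w => ω (w - v)
      left_inv := fun ω => funext fun w => by simp
      right_inv := fun ω => funext fun w => by simp
      measurable_toFun := measurable_shift v
      measurable_invFun := measurable_pi_lambda _ fun w => measurable_pi_apply (w - v) }
  have hmap : P.map e = P := hP.map_shift_eq v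
  calc ∫ ω, F (fun w => ω (w + v)) ∂P = ∫ ω, F (e ω) ∂P := rfl
    _ = ∫ ω, F ω ∂(P.map e) := (integral_map_equiv e F).symm
    _ = ∫ ω, F ω ∂P := by rw [hmap]

end Literature.Probability.LatticeModels.SixVertex

end
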